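import Summits.HodgeConjecture.HodgeConjecture.Theses.SecondaryPeriods
import Summits.HodgeConjecture.HodgeConjecture.Theorems.SecondaryPeriodsLevelOneConiveauThreefoldsKnownRegime
import Summits.HodgeConjecture.HodgeConjecture.Theorems.SecondaryPeriodsLevelOneConiveauThreefoldsStubLevelOneSpanOfCurve
import Literature.Barriers.HodgeConjecture.DecompositionOfTheDiagonalHodgeHolds

/-!
# Line `vanishing-genus` — crux `LevelOneConiveauThreefolds` (stmt-HodgeConjecture-10376), route `SecondaryPeriods`

Forward generator G4 `ladder-down` (unit `fwd-ladder-HodgeConjecture-52`, 2026-08-17). The ladder TOP named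
by the tribunal seed, `SecondaryPeriods.RiemannWeightOne` (stmt-HodgeConjecture-16406), is a PROVED theorem of
the tree (`Theorems.riemannWeightOne_proof`, p162080); every rung below it closes `rung → top` by
`fun _ ↦ riemannWeightOne_proof`, so no rung may be filed under it (the tribunal's "MiddleAll → RiemannWeightOne
by `exact?` in 1 ms" is that artefact). The ladder is therefore built, as the brief allows, on the parent route's
OPEN crux `LevelOneConiveauThreefolds` = Grothendieck's amended GHC(3,1) for smooth projective threefolds.

## The graded family (ladder parameter = a SECTOR `𝒞` of pairs (threefold `Y`, Hodge model `A`))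

`Rung 𝒞` := the body of the crux restricted to the pairs in `𝒞` (`ConiveauOneAt Y A`: every rationally spanned
sub-Hodge structure `W ⊆ H^{2,1} ⊕ H^{1,2}` of `H³(Y(ℂ); ℂ)` lies in `N¹H³(Y)`); antitone in `𝒞`
(`Rung.anti`); `Rung ⊤ ↔` the crux (`rung_top_iff`).

* FLOOR `𝒞 = chowSurface` (`CH₀(Y)` supported on a surface): PROVED in the tree, hypothesis-free —
  `Theorems.stub_knownRegime_chowZeroOnSurface` / Literature
  `supportedClasses_three_one_eq_top_of_hasChowZeroSupportedInDimLE_two` (Bloch–Srinivas decomposition of the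
  diagonal + Andreotti–Frankel) ⇒ `rung_chowSurface` (the F3 witness; also `Lines/vanishing-genus_special.lean`).
* RUNG 1 `𝒞 = genusZero` (`A.hodgePQ 3 3 0 = ⊥`, i.e. `h^{3,0}(Y) = 0`): the registered stub
  `stub_vanishingGenusConiveauOne` = named statement `VanishingGenusConiveauOne` — "a smooth projective threefold
  with no holomorphic 3-form has `H³ = N¹H³` on rationally spanned level-one sub-Hodge structures" = GHC(3,1) in the
  sector where the level-one hypothesis is automatic. The floor sits INSIDE this sector by a tree theorem
  (Voisin II Thm. 10.17, `BlochSrinivas1983_hodgeTypeL0_vanish_of_chowZeroSupported_holds`: `CH₀ ≤` surface ⇒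
  `H^{3,0} = 0`; `chowSurface_le_genusZero`), so RUNG 1 ⇒ FLOOR (`rung_chowSurface_of_vanishingGenus`) and the ONE
  move from the floor is: hypothesis "`CH₀(Y)` supported on a surface" generalised to its Hodge-theoretic shadow
  "`h^{3,0}(Y) = 0`". The converse shadow ⇒ Chow is Bloch's conjecture in dimension 3 (`GenBlochThreefolds`, typed;
  Voisin II Conj. 11.23 (k = 0) restricted, Voisin 2025 Conj. 5.12 — open even for surfaces with `p_g = q = 0`,
  Rem. 5.13), and `vanishingGenusConiveauOne_of_genBloch` records that it is exactly the missing input of the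
  floor's METHOD (the ladder ceiling of the decomposition-of-the-diagonal family; BC9: capped at the floor, lift =
  `GenBlochThreefolds`, not a registered stub: RUNG 1 may also fall sector-wise to Künneth/fibration arguments that
  never touch `CH₀`).
* GAP (the remaining sectors, where the route's bet lives): `stub_genusOneConiveauOne` (`h^{3,0} = 1`; VERBATIM the
  route's support item `AttractorPlanesConiveauOne`, stmt-HodgeConjecture-10377 — rank-2 attractor planes on
  Calabi–Yau threefolds; summit-hard there: HC on `Y × E`, HEART-c3) and `stub_largeGenusConiveauOne`
  (`h^{3,0} ≥ 2`, typed as `H^{3,0} ≠ ⊥ ∧ finrank ≠ 1` so that the trichotomy is pure logic).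
* COMPOSITION `LevelOneConiveauThreefolds_of : stub₁ → stub₂ → stub₃ → crux` BY NAME, no `sorry` (trichotomy on
  `H^{3,0}(A)`; a trivial seam — the content is the sector cut, whose first sector has a proved floor and a
  located stopping point).

On-path / real-step calibrations (§3, all kernel-checked here; probes in the planner folder `bc/`):
crux → RUNG 1 (`vanishingGenusConiveauOne_of_levelOne`, restriction); `HodgeConjecture` → RUNG 1
(`vanishingGenusConiveauOne_of_hodgeConjecture`, via `Theorems.levelOneConiveauThreefolds_of_hodgeConjecture`);
RUNG 1 → FLOOR (`rung_chowSurface_of_vanishingGenus`); FLOOR ↛ RUNG 1, RUNG 1 ↛ crux, RUNG 1 ↛ `HodgeConjecture`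
cheaply (`bc/VanishingGenusConiveauOne_probe.lean`: `exact? | simpa | aesop` fail).

Sources: [GrothendieckTopology1969, p. 301] [VoisinHodgeII2003, Thm. 10.17, Cor. 10.21, Thm. 10.31, Conj. 11.23,
Thm. 11.10] [Voisin2025JOMP = doi:10.56994/jomp.001.001.002, Prop. 5.5, Thm. 5.6, Cor. 5.7, Rem. 5.9, Conj. 5.12,
Rem. 5.13] [BlochSrinivas1983, Thm. 1] [Kimura2005 = doi:10.1007/s00208-004-0577-3].
-/

noncomputable section

set_option linter.dupNamespace false

namespace Summit.HodgeConjecture.HodgeConjecture.Cruxes.LevelOneConiveauThreefolds.VanishingGenus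

open Literature.AlgebraicGeometry Literature.AlgebraicGeometry.Motives
open Literature.AlgebraicGeometry.HodgeTheory
open Literature.Barriers.HodgeConjecture

/-! ## §0 The graded family `Rung 𝒞` -/

/-- The body of the crux at one pair `(Y, A)`: every finite set `s` of rational classes of
`H³(Y(ℂ); ℂ)` whose span `W` is sub-Hodge in the model `A` and of Hodge coniveau `≥ 1` spans a
subspace of `N¹H³(Y)`. [GrothendieckTopology1969, p. 301] -/
def ConiveauOneAt (Y : SchemeOver ℂ) (A : HodgeModel 3 Y) : Prop :=
  ∀ (s : Finset (complexBetti Y 3)), (∀ c ∈ s, IsRationalClass c) →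
    (Submodule.span ℂ (↑s : Set (complexBetti Y 3))).map (A.pullback 3).hom =
      (⨆ (p : ℕ) (q : ℕ) (_ : p + q = 3),
        (Submodule.span ℂ (↑s : Set (complexBetti Y 3))).map (A.pullback 3).hom ⊓ A.hodgePQ 3 p q) →
    (Submodule.span ℂ (↑s : Set (complexBetti Y 3))).map (A.pullback 3).hom ≤
      (⨆ (p : ℕ) (q : ℕ) (_ : p + q = 3) (_ : 1 ≤ p) (_ : 1 ≤ q), A.hodgePQ 3 p q) →
    Submodule.span ℂ (↑s : Set (complexBetti Y 3)) ≤ supportedClasses Y 3 1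

/-- **The graded family.** `Rung 𝒞`: GHC(3,1) (the crux body) for every smooth projective threefold
`Y` and Hodge model `A` in the sector `𝒞`. -/
def Rung (𝒞 : ∀ ⦃Y : SchemeOver ℂ⦄, IsSmoothProjective 3 Y → HodgeModel 3 Y → Prop) : Prop :=
  ∀ ⦃Y : SchemeOver ℂ⦄ (hY : IsSmoothProjective 3 Y) (A : HodgeModel 3 Y), 𝒞 hY A → ConiveauOneAt Y A

/-- `Rung` is antitone in the sector: a larger sector is a stronger rung. -/
theorem Rung.anti {𝒞 𝒞' : ∀ ⦃Y : SchemeOver ℂ⦄, IsSmoothProjective 3 Y → HodgeModel 3 Y → Prop}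
    (h : ∀ ⦃Y : SchemeOver ℂ⦄ (hY : IsSmoothProjective 3 Y) (A : HodgeModel 3 Y), 𝒞 hY A → 𝒞' hY A) :
    Rung 𝒞' → Rung 𝒞 :=
  fun hR _ hY A hA ↦ hR hY A (h hY A hA)

/-- FLOOR sector: `CH₀(Y)` is supported on a closed algebraic subset of dimension `≤ 2`. -/
def chowSurface : ∀ ⦃Y : SchemeOver ℂ⦄, IsSmoothProjective 3 Y → HodgeModel 3 Y → Prop :=
  fun Y _ _ ↦ HasChowZeroSupportedInDimLE Y 2

/-- RUNG-1 sector: vanishing geometric genus, `H^{3,0}(Y^an) = 0` in the model `A`. -/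
def genusZero : ∀ ⦃Y : SchemeOver ℂ⦄, IsSmoothProjective 3 Y → HodgeModel 3 Y → Prop :=
  fun _ _ A ↦ A.hodgePQ 3 3 0 = ⊥

/-- GAP sector (a): `h^{3,0} = 1` (the route's attractor habitat, item `AttractorPlanesConiveauOne`). -/
def genusOne : ∀ ⦃Y : SchemeOver ℂ⦄, IsSmoothProjective 3 Y → HodgeModel 3 Y → Prop :=
  fun _ _ A ↦ Module.finrank ℂ (A.hodgePQ 3 3 0) = 1

/-- GAP sector (b): `h^{3,0} ≥ 2` (typed as the logical complement of the two previous sectors). -/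
def genusLarge : ∀ ⦃Y : SchemeOver ℂ⦄, IsSmoothProjective 3 Y → HodgeModel 3 Y → Prop :=
  fun _ _ A ↦ A.hodgePQ 3 3 0 ≠ ⊥ ∧ Module.finrank ℂ (A.hodgePQ 3 3 0) ≠ 1

/-- The TOP of the ladder is the crux: `Rung ⊤ ↔ LevelOneConiveauThreefolds`. -/
theorem rung_top_iff :
    Rung (fun _ _ _ ↦ True) ↔ Theses.SecondaryPeriods.LevelOneConiveauThreefolds :=
  ⟨fun h _ hY A s hs hsub hlev ↦ h hY A trivial s hs hsub hlev,
   fun h _ hY A _ s hs hsub hlev ↦ h hY A s hs hsub hlev⟩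

/-! ## §1 The statements of the line -/

/-- **RUNG 1 — `VanishingGenusConiveauOne`: GHC(3,1) for threefolds with no holomorphic 3-form.**
For `Y` smooth projective of dimension 3 and a Hodge model `A` with `H^{3,0} = ⊥`, every rationally
spanned level-one sub-Hodge structure of `H³(Y(ℂ); ℂ)` lies in `N¹H³(Y)`. Known when `CH₀(Y)` is
supported on a surface (FLOOR, in tree); open in general (the Chow input is Bloch's conjecture in
dimension 3). [VoisinHodgeII2003, Thm. 10.17, Conj. 11.23] [Voisin2025JOMP, Conj. 4.6, Cor. 5.7, Conj. 5.12,
Rem. 5.13] [GrothendieckTopology1969, p. 301] -/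
def VanishingGenusConiveauOne : Prop :=
  ∀ ⦃Y : SchemeOver ℂ⦄, IsSmoothProjective 3 Y → ∀ (A : HodgeModel 3 Y), A.hodgePQ 3 3 0 = ⊥ →
    ∀ (s : Finset (complexBetti Y 3)), (∀ c ∈ s, IsRationalClass c) →
    (Submodule.span ℂ (↑s : Set (complexBetti Y 3))).map (A.pullback 3).hom =
      (⨆ (p : ℕ) (q : ℕ) (_ : p + q = 3),
        (Submodule.span ℂ (↑s : Set (complexBetti Y 3))).map (A.pullback 3).hom ⊓ A.hodgePQ 3 p q) →
    (Submodule.span ℂ (↑s : Set (complexBetti Y 3))).map (A.pullback 3).hom ≤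
      (⨆ (p : ℕ) (q : ℕ) (_ : p + q = 3) (_ : 1 ≤ p) (_ : 1 ≤ q), A.hodgePQ 3 p q) →
    Submodule.span ℂ (↑s : Set (complexBetti Y 3)) ≤ supportedClasses Y 3 1

/-- RUNG 1 is the member `genusZero` of the graded family (definitionally). -/
theorem vanishingGenusConiveauOne_iff_rung : VanishingGenusConiveauOne ↔ Rung genusZero :=
  ⟨fun h _ hY A hA s hs hsub hlev ↦ h hY A hA s hs hsub hlev,
   fun h _ hY A hA s hs hsub hlev ↦ h hY A hA s hs hsub hlev⟩

/-- **GAP (a) — `GenusOneConiveauOne`**: the sector `h^{3,0} = 1`; VERBATIM the route's support item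
`Theses.SecondaryPeriods.AttractorPlanesConiveauOne` (stmt-HodgeConjecture-10377). [CandelasEtAl2020 §6]
[BonischEtAl2024 §3.3] [GrothendieckTopology1969, p. 301] -/
def GenusOneConiveauOne : Prop :=
  ∀ ⦃Y : SchemeOver ℂ⦄, IsSmoothProjective 3 Y → ∀ (A : HodgeModel 3 Y), Module.finrank ℂ (A.hodgePQ 3 3 0) = 1 →
    ∀ (s : Finset (complexBetti Y 3)), (∀ c ∈ s, IsRationalClass c) →
    (Submodule.span ℂ (↑s : Set (complexBetti Y 3))).map (A.pullback 3).hom =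
      (⨆ (p : ℕ) (q : ℕ) (_ : p + q = 3),
        (Submodule.span ℂ (↑s : Set (complexBetti Y 3))).map (A.pullback 3).hom ⊓ A.hodgePQ 3 p q) →
    (Submodule.span ℂ (↑s : Set (complexBetti Y 3))).map (A.pullback 3).hom ≤
      (⨆ (p : ℕ) (q : ℕ) (_ : p + q = 3) (_ : 1 ≤ p) (_ : 1 ≤ q), A.hodgePQ 3 p q) →
    Submodule.span ℂ (↑s : Set (complexBetti Y 3)) ≤ supportedClasses Y 3 1

/-- The gap (a) statement IS the route item `AttractorPlanesConiveauOne` (definitionally). -/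
theorem genusOneConiveauOne_iff_attractorPlanes :
    GenusOneConiveauOne ↔ Theses.SecondaryPeriods.AttractorPlanesConiveauOne := Iff.rfl

/-- **GAP (b) — `LargeGenusConiveauOne`**: the sector `h^{3,0} ≥ 2` (complement of the two others).
[GrothendieckTopology1969, p. 301] [VoisinHodgeI2002, Conj. 11.37] -/
def LargeGenusConiveauOne : Prop :=
  ∀ ⦃Y : SchemeOver ℂ⦄, IsSmoothProjective 3 Y → ∀ (A : HodgeModel 3 Y), A.hodgePQ 3 3 0 ≠ ⊥ →
    Module.finrank ℂ (A.hodgePQ 3 3 0) ≠ 1 →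
    ∀ (s : Finset (complexBetti Y 3)), (∀ c ∈ s, IsRationalClass c) →
    (Submodule.span ℂ (↑s : Set (complexBetti Y 3))).map (A.pullback 3).hom =
      (⨆ (p : ℕ) (q : ℕ) (_ : p + q = 3),
        (Submodule.span ℂ (↑s : Set (complexBetti Y 3))).map (A.pullback 3).hom ⊓ A.hodgePQ 3 p q) →
    (Submodule.span ℂ (↑s : Set (complexBetti Y 3))).map (A.pullback 3).hom ≤
      (⨆ (p : ℕ) (q : ℕ) (_ : p + q = 3) (_ : 1 ≤ p) (_ : 1 ≤ q), A.hodgePQ 3 p q) →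
    Submodule.span ℂ (↑s : Set (complexBetti Y 3)) ≤ supportedClasses Y 3 1

/-! ## §2 The registered stubs (`sorry` lives only here) — each restates its §1 statement VERBATIM -/

/-- **STUB 1 · `stub_vanishingGenusConiveauOne`** (RUNG 1, the line's load-bearing step; open, floor proved). -/
theorem stub_vanishingGenusConiveauOne :
    ∀ ⦃Y : SchemeOver ℂ⦄, IsSmoothProjective 3 Y → ∀ (A : HodgeModel 3 Y), A.hodgePQ 3 3 0 = ⊥ →
      ∀ (s : Finset (complexBetti Y 3)), (∀ c ∈ s, IsRationalClass c) →
      (Submodule.span ℂ (↑s : Set (complexBetti Y 3))).map (A.pullback 3).hom =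
        (⨆ (p : ℕ) (q : ℕ) (_ : p + q = 3),
          (Submodule.span ℂ (↑s : Set (complexBetti Y 3))).map (A.pullback 3).hom ⊓ A.hodgePQ 3 p q) →
      (Submodule.span ℂ (↑s : Set (complexBetti Y 3))).map (A.pullback 3).hom ≤
        (⨆ (p : ℕ) (q : ℕ) (_ : p + q = 3) (_ : 1 ≤ p) (_ : 1 ≤ q), A.hodgePQ 3 p q) →
      Submodule.span ℂ (↑s : Set (complexBetti Y 3)) ≤ supportedClasses Y 3 1 := by
  sorry

/-- **STUB 2 · `stub_genusOneConiveauOne`** (GAP (a) = item `AttractorPlanesConiveauOne`, stmt-HodgeConjecture-10377). -/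
theorem stub_genusOneConiveauOne :
    ∀ ⦃Y : SchemeOver ℂ⦄, IsSmoothProjective 3 Y → ∀ (A : HodgeModel 3 Y), Module.finrank ℂ (A.hodgePQ 3 3 0) = 1 →
      ∀ (s : Finset (complexBetti Y 3)), (∀ c ∈ s, IsRationalClass c) →
      (Submodule.span ℂ (↑s : Set (complexBetti Y 3))).map (A.pullback 3).hom =
        (⨆ (p : ℕ) (q : ℕ) (_ : p + q = 3),
          (Submodule.span ℂ (↑s : Set (complexBetti Y 3))).map (A.pullback 3).hom ⊓ A.hodgePQ 3 p q) →
      (Submodule.span ℂ (↑s : Set (complexBetti Y 3))).map (A.pullback 3).hom ≤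
        (⨆ (p : ℕ) (q : ℕ) (_ : p + q = 3) (_ : 1 ≤ p) (_ : 1 ≤ q), A.hodgePQ 3 p q) →
      Submodule.span ℂ (↑s : Set (complexBetti Y 3)) ≤ supportedClasses Y 3 1 := by
  sorry

/-- **STUB 3 · `stub_largeGenusConiveauOne`** (GAP (b), sector `h^{3,0} ≥ 2`). -/
theorem stub_largeGenusConiveauOne :
    ∀ ⦃Y : SchemeOver ℂ⦄, IsSmoothProjective 3 Y → ∀ (A : HodgeModel 3 Y), A.hodgePQ 3 3 0 ≠ ⊥ →
      Module.finrank ℂ (A.hodgePQ 3 3 0) ≠ 1 →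
      ∀ (s : Finset (complexBetti Y 3)), (∀ c ∈ s, IsRationalClass c) →
      (Submodule.span ℂ (↑s : Set (complexBetti Y 3))).map (A.pullback 3).hom =
        (⨆ (p : ℕ) (q : ℕ) (_ : p + q = 3),
          (Submodule.span ℂ (↑s : Set (complexBetti Y 3))).map (A.pullback 3).hom ⊓ A.hodgePQ 3 p q) →
      (Submodule.span ℂ (↑s : Set (complexBetti Y 3))).map (A.pullback 3).hom ≤
        (⨆ (p : ℕ) (q : ℕ) (_ : p + q = 3) (_ : 1 ≤ p) (_ : 1 ≤ q), A.hodgePQ 3 p q) →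
      Submodule.span ℂ (↑s : Set (complexBetti Y 3)) ≤ supportedClasses Y 3 1 := by
  sorry

/-! ### Consistency: each named statement IS its registered stub (definitionally) -/

theorem vanishingGenusConiveauOne_holds : VanishingGenusConiveauOne := stub_vanishingGenusConiveauOne
theorem genusOneConiveauOne_holds : GenusOneConiveauOne := stub_genusOneConiveauOne
theorem largeGenusConiveauOne_holds : LargeGenusConiveauOne := stub_largeGenusConiveauOne

/-! ### Name-keyed aliases of the statements (the hypotheses of the composition; admissible BY NAME) -/
namespace Registered

/-- Alias of `VanishingGenusConiveauOne` keyed by the registered stub name. -/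
abbrev stub_vanishingGenusConiveauOne : Prop := VanishingGenusConiveauOne
/-- Alias of `GenusOneConiveauOne` keyed by the registered stub name. -/
abbrev stub_genusOneConiveauOne : Prop := GenusOneConiveauOne
/-- Alias of `LargeGenusConiveauOne` keyed by the registered stub name. -/
abbrev stub_largeGenusConiveauOne : Prop := LargeGenusConiveauOne

end Registered

/-! ## §3 Calibrations: floor, regime inclusion, on-path (no `sorry` from here on) -/

/-- **FLOOR (F3 witness): the rung `chowSurface` is a theorem of the tree** — GHC(3,1) for threefolds
with `CH₀` supported on a surface, all ranks, hypothesis-free (`Theorems.stub_knownRegime_chowZeroOnSurface`,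
from `supportedClasses_three_one_eq_top_of_hasChowZeroSupportedInDimLE_two`: Bloch–Srinivas + Andreotti–Frankel).
[BlochSrinivas1983, Thm. 1] [VoisinHodgeII2003, Cor. 10.21] -/
theorem rung_chowSurface : Rung chowSurface :=
  fun _ hY A hW s hs hsub hlev ↦ Theorems.stub_knownRegime_chowZeroOnSurface hY hW A s hs hsub hlev

/-- **Regime inclusion FLOOR ⊆ RUNG-1 sector (Voisin II Thm. 10.17, PROVED in the tree):** `CH₀(Y)`
supported on a surface forces `H^{3,0} = ⊥` in every Hodge model.
[VoisinHodgeII2003, Thm. 10.17] [BlochSrinivas1983, Thm. 1 (1)] -/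
theorem chowSurface_le_genusZero ⦃Y : SchemeOver ℂ⦄ (hY : IsSmoothProjective 3 Y) (A : HodgeModel 3 Y) :
    chowSurface hY A → genusZero hY A :=
  fun hW ↦ BlochSrinivas1983_hodgeTypeL0_vanish_of_chowZeroSupported_iff_hodgePQ_eq_bot.1
    BlochSrinivas1983_hodgeTypeL0_vanish_of_chowZeroSupported_holds hY hW (show 2 < 3 by norm_num) A

/-- **RUNG 1 ⇒ FLOOR** (monotonicity along the proved regime inclusion): the rung is at least the floor. -/
theorem rung_chowSurface_of_vanishingGenus (h : VanishingGenusConiveauOne) : Rung chowSurface :=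
  Rung.anti chowSurface_le_genusZero (vanishingGenusConiveauOne_iff_rung.1 h)

/-- **On-path (crux ⇒ RUNG 1):** restriction of the crux to the sector. -/
theorem vanishingGenusConiveauOne_of_levelOne (h : Theses.SecondaryPeriods.LevelOneConiveauThreefolds) :
    VanishingGenusConiveauOne :=
  fun _ hY A _ s hs hsub hlev ↦ h hY A s hs hsub hlev

/-- **On-path (summit ⇒ RUNG 1):** `HodgeConjecture → LevelOneConiveauThreefolds` is a theorem of the
tree (`Theorems.levelOneConiveauThreefolds_of_hodgeConjecture`, Grothendieck 1969 p. 301 + Riemann), hence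
`HodgeConjecture → RUNG 1`. The rung is a CONSEQUENCE of the summit, pinned below to a proved floor (F4). -/
theorem vanishingGenusConiveauOne_of_hodgeConjecture (hHC : _root_.HodgeConjecture) : VanishingGenusConiveauOne :=
  vanishingGenusConiveauOne_of_levelOne (Theorems.levelOneConiveauThreefolds_of_hodgeConjecture hHC)

/-- **The ceiling lift, typed: Bloch's conjecture for threefolds with `h^{3,0} = 0`** — the Hodge-theoretic
shadow `H^{3,0} = 0` implies that `CH₀(Y)` is supported on a surface (converse of Voisin II Thm. 10.17 in
dimension 3; Conj. 11.23 with `k = 0` asks more, `CH₀(Y)_ℚ = ℚ` under `h^{1,0} = h^{2,0} = h^{3,0} = 0`;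
this is the graded piece relevant to `H³`). OPEN (open already for surfaces with `p_g = q = 0`).
NOT a registered stub: one sufficient input for RUNG 1, not a necessary one.
[VoisinHodgeII2003, Conj. 11.22–11.23] [Voisin2025JOMP, Conj. 5.12, Rem. 5.13] -/
def GenBlochThreefolds : Prop :=
  ∀ ⦃Y : SchemeOver ℂ⦄, IsSmoothProjective 3 Y → ∀ (A : HodgeModel 3 Y), A.hodgePQ 3 3 0 = ⊥ →
    HasChowZeroSupportedInDimLE Y 2

/-- **Lift ⇒ RUNG 1:** Bloch's conjecture in dimension 3 feeds the floor's method (decomposition of the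
diagonal) and yields RUNG 1 — the exact sense in which RUNG 1 is "generalised Bloch ∘ FLOOR".
[Voisin2025JOMP, Prop. 5.5 and Thm. 5.6] -/
theorem vanishingGenusConiveauOne_of_genBloch (hB : GenBlochThreefolds) : VanishingGenusConiveauOne :=
  fun _ hY A hA s hs hsub hlev ↦ rung_chowSurface hY A (hB hY A hA) s hs hsub hlev

/-! ## §4 The composition: the stubs imply the crux, BY NAME (kernel-checked; no `sorry`) -/

/-- **`LevelOneConiveauThreefolds_of`** — the glue of the line: trichotomy on the geometric genus of the
model, `H^{3,0}(A) = ⊥` (STUB 1 = RUNG 1) / `finrank H^{3,0}(A) = 1` (STUB 2 = `AttractorPlanesConiveauOne`)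
/ otherwise (STUB 3). Hypotheses: the three registered stubs BY NAME; conclusion: the route decl BY NAME. -/
theorem LevelOneConiveauThreefolds_of (h0 : Registered.stub_vanishingGenusConiveauOne)
    (h1 : Registered.stub_genusOneConiveauOne) (h2 : Registered.stub_largeGenusConiveauOne) :
    Summit.HodgeConjecture.HodgeConjecture.Theses.SecondaryPeriods.LevelOneConiveauThreefolds := by
  intro Y hY A s hs hsub hlev
  by_cases hz : A.hodgePQ 3 3 0 = ⊥
  · exact h0 hY A hz s hs hsub hlev
  by_cases hone : Module.finrank ℂ (A.hodgePQ 3 3 0) = 1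
  · exact h1 hY A hone s hs hsub hlev
  · exact h2 hY A hz hone s hs hsub hlev

/-- Wiring check: the registered (sorried) stubs feed the composition as stated. -/
example : Summit.HodgeConjecture.HodgeConjecture.Theses.SecondaryPeriods.LevelOneConiveauThreefolds :=
  LevelOneConiveauThreefolds_of stub_vanishingGenusConiveauOne stub_genusOneConiveauOne
    stub_largeGenusConiveauOne

/-- Sector bookkeeping: the three sectors exhaust all pairs `(Y, A)` (pure logic). -/
theorem sector_trichotomy ⦃Y : SchemeOver ℂ⦄ (hY : IsSmoothProjective 3 Y) (A : HodgeModel 3 Y) :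
    genusZero hY A ∨ genusOne hY A ∨ genusLarge hY A := by
  by_cases hz : A.hodgePQ 3 3 0 = ⊥
  · exact Or.inl hz
  by_cases hone : Module.finrank ℂ (A.hodgePQ 3 3 0) = 1
  · exact Or.inr (Or.inl hone)
  · exact Or.inr (Or.inr ⟨hz, hone⟩)

end Summit.HodgeConjecture.HodgeConjecture.Cruxes.LevelOneConiveauThreefolds.VanishingGenus

end
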